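import Mathlib.Analysis.InnerProductSpace.Basic
import Mathlib.Analysis.SpecialFunctions.Pow.Real
import Mathlib.Data.Nat.Log
import HarnessLib

/-!
# Fair partitions of finitely many vectors (greedy vector balancing)

Topic `Literature/Combinatorics` (namespace `Literature.Combinatorics.VectorBalancing`).
Everything in this file is PROVED; there are no definitions and no named facts.

For finitely many vectors `w_x` (`x ∈ s`) of a real inner product space and `M ≥ 1` there is a
partition of `s` into `M` classes each of which carries a share `θ_c ∈ [1/(2M), 2/M]` of the total
`T = ∑ w_x` up to an error of norm at most `2 √(∑ ‖w_x‖²)` — independent of the number of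
vectors (`exists_fair_partition`). This is the elementary "small atoms are fairly divisible"
statement (greedy signs by the parallelogram law, `exists_signs_sq_norm_sum_le`; recursive
halving into `2^r` classes, `exists_dyadic_partition`; merging pairs of dyadic classes,
`exists_fair_partition`), a weak constructive form of the Bárány–Grinberg vector balancing
theorem. It replaces, in the tree's proof of Booker–Thorne 2014, Proposition 10
(`Literature/Barriers/RiemannHypothesis/DavenportHeilbronnDegreeTwo*.lean`), the partition of the
primes into residue classes (which in print needs the quasi-orthogonality of Hecke eigenvalues in
arithmetic progressions): the atoms are the matrices `λ(p)λ(p)ᵀ p^{-σ}`, whose squared norms are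
summable uniformly in `σ ≥ 1`.

## References

* [BaranyGrinberg1981] I. Bárány, V. S. Grinberg, *On some combinatorial questions in
  finite-dimensional spaces*, Linear Algebra Appl. 41 (1981), 1–9 (the sharp balancing theorem;
  only the trivial greedy bound is proved here).
* [BookerThorne2014] A. R. Booker, F. Thorne, Algebra Number Theory 8 (2014), Prop. 10 (the
  consumer; "it is likely that [the progressions] could be avoided at the expense of making the
  proof more complicated", §1, Remarks).
-/

noncomputable section

open Finset Real

namespace Literature.Combinatorics

namespace VectorBalancing

variable {α : Type*} [DecidableEq α] {E : Type*} [NormedAddCommGroup E] [InnerProductSpace ℝ E]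

/-! ### Greedy signs -/

/-- **Greedy signs.** For vectors `w_x`, `x ∈ s`, there are signs `ε_x = ±1` with
`‖∑ ε_x w_x‖² ≤ ∑ ‖w_x‖²`: add the vectors one at a time, choosing each sign so that the
parallelogram law `‖S + w‖² + ‖S − w‖² = 2‖S‖² + 2‖w‖²` works in one's favour. [folklore] -/
theorem exists_signs_sq_norm_sum_le (s : Finset α) (w : α → E) :
    ∃ ε : α → ℝ, (∀ x, ε x = 1 ∨ ε x = -1) ∧
      ‖∑ x ∈ s, ε x • w x‖ ^ 2 ≤ ∑ x ∈ s, ‖w x‖ ^ 2 := by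
  induction s using Finset.induction_on with
  | empty => exact ⟨fun _ ↦ 1, fun _ ↦ Or.inl rfl, by simp⟩
  | insert a s ha ih =>
    obtain ⟨ε, hε, hle⟩ := ih
    set S : E := ∑ x ∈ s, ε x • w x with hS
    have hpar : ‖S + w a‖ ^ 2 + ‖S - w a‖ ^ 2 = 2 * ‖S‖ ^ 2 + 2 * ‖w a‖ ^ 2 := by
      have := parallelogram_law_with_norm ℝ S (w a)
      linarith
    -- the sum over `s` does not see the value at `a`
    have hupd : ∀ b : ℝ, ∑ x ∈ s, Function.update ε a b x • w x = S := by
      intro b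
      refine Finset.sum_congr rfl fun x hx ↦ ?_
      rw [Function.update_of_ne (ne_of_mem_of_not_mem hx ha)]
    by_cases hcase : ‖S + w a‖ ^ 2 ≤ ‖S - w a‖ ^ 2
    · refine ⟨Function.update ε a 1, fun x ↦ ?_, ?_⟩
      · rcases eq_or_ne x a with rfl | hx
        · simp
        · rw [Function.update_of_ne hx]; exact hε x
      · rw [Finset.sum_insert ha, Finset.sum_insert ha, hupd, Function.update_self, one_smul,
          add_comm (w a)]
        linarith
    · push Not at hcase
      refine ⟨Function.update ε a (-1), fun x ↦ ?_, ?_⟩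
      · rcases eq_or_ne x a with rfl | hx
        · simp
        · rw [Function.update_of_ne hx]; exact hε x
      · rw [Finset.sum_insert ha, Finset.sum_insert ha, hupd, Function.update_self, neg_one_smul,
          add_comm (-w a), ← sub_eq_add_neg]
        linarith

/-! ### Dyadic partitions -/

omit [DecidableEq α] in
/-- Half of a class selected by signs: `∑_{ε = 1} w = ½ (∑ w + ∑ ε w)`. [folklore] -/
theorem sum_filter_eq_one_eq (s : Finset α) (w : α → E) {ε : α → ℝ}
    (hε : ∀ x, ε x = 1 ∨ ε x = -1) :
    ∑ x ∈ s.filter (fun x ↦ ε x = 1), w x =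
      (1 / 2 : ℝ) • (∑ x ∈ s, w x + ∑ x ∈ s, ε x • w x) := by
  rw [Finset.sum_filter, ← Finset.sum_add_distrib, Finset.smul_sum]
  refine Finset.sum_congr rfl fun x _ ↦ ?_
  rcases hε x with h | h
  · rw [if_pos h, h, one_smul, smul_add]
    rw [← add_smul]; norm_num
  · rw [if_neg (by rw [h]; norm_num), h, neg_one_smul, add_neg_cancel, smul_zero]

omit [DecidableEq α] in
/-- The other half: `∑_{ε ≠ 1} w = ½ (∑ w − ∑ ε w)`. [folklore] -/
theorem sum_filter_ne_one_eq (s : Finset α) (w : α → E) {ε : α → ℝ}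
    (hε : ∀ x, ε x = 1 ∨ ε x = -1) :
    ∑ x ∈ s.filter (fun x ↦ ¬ ε x = 1), w x =
      (1 / 2 : ℝ) • (∑ x ∈ s, w x - ∑ x ∈ s, ε x • w x) := by
  rw [Finset.sum_filter, ← Finset.sum_sub_distrib, Finset.smul_sum]
  refine Finset.sum_congr rfl fun x _ ↦ ?_
  rcases hε x with h | h
  · rw [if_neg (by rw [h]; norm_num), h, one_smul, sub_self, smul_zero]
  · rw [if_pos (by rw [h]; norm_num), h, neg_one_smul, sub_neg_eq_add]
    rw [← two_smul ℝ (w x), smul_smul]; norm_num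

omit [DecidableEq α] [InnerProductSpace ℝ E] in
/-- The "energy" `∑ ‖w_x‖²` of a sub-family is at most that of the family. [folklore] -/
theorem sum_sq_norm_filter_le (s : Finset α) (w : α → E) (p : α → Prop) [DecidablePred p] :
    ∑ x ∈ s.filter p, ‖w x‖ ^ 2 ≤ ∑ x ∈ s, ‖w x‖ ^ 2 :=
  Finset.sum_le_sum_of_subset_of_nonneg (Finset.filter_subset _ _) fun _ _ _ ↦ by positivity

/-- **Recursive halving.** For every `r` there is a partition of `s` into `2^r` classes
(`cls x < 2^r`) each of whose sums is `2^{-r} ∑_s w` up to an error of norm at most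
`(1 − 2^{-r}) √(∑_s ‖w_x‖²)`. [folklore] -/
theorem exists_dyadic_partition (s : Finset α) (w : α → E) (r : ℕ) :
    ∃ cls : α → ℕ, (∀ x, cls x < 2 ^ r) ∧ ∀ c : ℕ, c < 2 ^ r →
      ‖∑ x ∈ s.filter (fun x ↦ cls x = c), w x - ((1 / 2 : ℝ) ^ r) • ∑ x ∈ s, w x‖ ≤
        (1 - (1 / 2 : ℝ) ^ r) * Real.sqrt (∑ x ∈ s, ‖w x‖ ^ 2) := by
  set W : ℝ := Real.sqrt (∑ x ∈ s, ‖w x‖ ^ 2) with hW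
  have hW0 : 0 ≤ W := Real.sqrt_nonneg _
  induction r with
  | zero =>
    refine ⟨fun _ ↦ 0, fun _ ↦ by simp, fun c hc ↦ ?_⟩
    have hc0 : c = 0 := by simpa using hc
    subst hc0
    simp
  | succ r ih =>
    obtain ⟨cls, hcls, herr⟩ := ih
    -- halve every class with greedy signs
    have hhalf : ∀ c : ℕ, ∃ ε : α → ℝ, (∀ x, ε x = 1 ∨ ε x = -1) ∧
        ‖∑ x ∈ s.filter (fun x ↦ cls x = c), ε x • w x‖ ^ 2 ≤
          ∑ x ∈ s.filter (fun x ↦ cls x = c), ‖w x‖ ^ 2 := fun c ↦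
      exists_signs_sq_norm_sum_le _ w
    choose ε hε hεle using hhalf
    have hεW : ∀ c, ‖∑ x ∈ s.filter (fun x ↦ cls x = c), ε c x • w x‖ ≤ W := by
      intro c
      rw [hW, ← Real.sqrt_sq (norm_nonneg _)]
      exact Real.sqrt_le_sqrt ((hεle c).trans (sum_sq_norm_filter_le s w _))
    -- the refined classes
    refine ⟨fun x ↦ 2 * cls x + (if ε (cls x) x = 1 then 0 else 1), fun x ↦ ?_, fun c' hc' ↦ ?_⟩
    · have := hcls x
      show 2 * cls x + (if ε (cls x) x = 1 then 0 else 1) < 2 ^ (r + 1)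
      split_ifs <;> rw [pow_succ] <;> omega
    · -- write `c' = 2 c + b`
      set c : ℕ := c' / 2 with hc
      have hc2 : c < 2 ^ r := by
        rw [hc, pow_succ] at *
        omega
      have hT := herr c hc2
      rcases Nat.even_or_odd c' with heven | hodd
      · -- `b = 0`: the class `{cls = c, ε = 1}`
        have hc' : c' = 2 * c := by obtain ⟨k, hk⟩ := heven; omega
        have hfilter : s.filter (fun x ↦ 2 * cls x + (if ε (cls x) x = 1 then 0 else 1) = c') =
            (s.filter (fun x ↦ cls x = c)).filter (fun x ↦ ε c x = 1) := by
          ext x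
          simp only [Finset.mem_filter]
          constructor
          · rintro ⟨hx, h⟩
            have hcx : cls x = c := by split_ifs at h <;> omega
            refine ⟨⟨hx, hcx⟩, ?_⟩
            by_contra hne
            rw [hcx, if_neg hne] at h
            omega
          · rintro ⟨⟨hx, hcx⟩, h1⟩
            refine ⟨hx, ?_⟩
            rw [hcx, if_pos h1]
            omega
        rw [hfilter, sum_filter_eq_one_eq _ w (hε c)]
        have : (1 / 2 : ℝ) • (∑ x ∈ s.filter (fun x ↦ cls x = c), w x +
              ∑ x ∈ s.filter (fun x ↦ cls x = c), ε c x • w x) -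
            ((1 / 2 : ℝ) ^ (r + 1)) • ∑ x ∈ s, w x =
            (1 / 2 : ℝ) • ((∑ x ∈ s.filter (fun x ↦ cls x = c), w x -
              ((1 / 2 : ℝ) ^ r) • ∑ x ∈ s, w x) +
              ∑ x ∈ s.filter (fun x ↦ cls x = c), ε c x • w x) := by
          rw [pow_succ, mul_smul]
          module
        rw [this, norm_smul, Real.norm_of_nonneg (by norm_num : (0 : ℝ) ≤ 1 / 2)]
        calc 1 / 2 * ‖(∑ x ∈ s.filter (fun x ↦ cls x = c), w x - ((1 / 2 : ℝ) ^ r) • ∑ x ∈ s, w x) +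
              ∑ x ∈ s.filter (fun x ↦ cls x = c), ε c x • w x‖
            ≤ 1 / 2 * ((1 - (1 / 2 : ℝ) ^ r) * W + W) := by
              gcongr
              exact (norm_add_le _ _).trans (add_le_add hT (hεW c))
          _ = (1 - (1 / 2 : ℝ) ^ (r + 1)) * W := by rw [pow_succ]; ring
      · -- `b = 1`: the class `{cls = c, ε ≠ 1}`
        have hc' : c' = 2 * c + 1 := by obtain ⟨k, hk⟩ := hodd; omega
        have hfilter : s.filter (fun x ↦ 2 * cls x + (if ε (cls x) x = 1 then 0 else 1) = c') =
            (s.filter (fun x ↦ cls x = c)).filter (fun x ↦ ¬ ε c x = 1) := by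
          ext x
          simp only [Finset.mem_filter]
          constructor
          · rintro ⟨hx, h⟩
            have hcx : cls x = c := by split_ifs at h <;> omega
            refine ⟨⟨hx, hcx⟩, ?_⟩
            intro h1
            rw [hcx, if_pos h1] at h
            omega
          · rintro ⟨⟨hx, hcx⟩, h1⟩
            refine ⟨hx, ?_⟩
            rw [hcx, if_neg h1]
            omega
        rw [hfilter, sum_filter_ne_one_eq _ w (hε c)]
        have : (1 / 2 : ℝ) • (∑ x ∈ s.filter (fun x ↦ cls x = c), w x -
              ∑ x ∈ s.filter (fun x ↦ cls x = c), ε c x • w x) -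
            ((1 / 2 : ℝ) ^ (r + 1)) • ∑ x ∈ s, w x =
            (1 / 2 : ℝ) • ((∑ x ∈ s.filter (fun x ↦ cls x = c), w x -
              ((1 / 2 : ℝ) ^ r) • ∑ x ∈ s, w x) -
              ∑ x ∈ s.filter (fun x ↦ cls x = c), ε c x • w x) := by
          rw [pow_succ, mul_smul]
          module
        rw [this, norm_smul, Real.norm_of_nonneg (by norm_num : (0 : ℝ) ≤ 1 / 2)]
        calc 1 / 2 * ‖(∑ x ∈ s.filter (fun x ↦ cls x = c), w x - ((1 / 2 : ℝ) ^ r) • ∑ x ∈ s, w x) -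
              ∑ x ∈ s.filter (fun x ↦ cls x = c), ε c x • w x‖
            ≤ 1 / 2 * ((1 - (1 / 2 : ℝ) ^ r) * W + W) := by
              gcongr
              exact (norm_sub_le _ _).trans (add_le_add hT (hεW c))
          _ = (1 - (1 / 2 : ℝ) ^ (r + 1)) * W := by rw [pow_succ]; ring

/-! ### Fair partitions into any number of classes -/

/-- **Fair partition into `M` classes.** For finitely many vectors `w_x` (`x ∈ s`) of a real inner
product space and `M ≥ 1` there is a partition of `s` into `M` classes (`cls x < M`) such that the
sum of each class is `θ_c ∑_s w_x + e_c` with `1/(2M) ≤ θ_c ≤ 2/M` and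
`‖e_c‖ ≤ 2 √(∑_s ‖w_x‖²)`. (Take `2^r` dyadic classes, `M ≤ 2^r < 2M`, and merge the classes
`c` and `c + M`.) [folklore] -/
theorem exists_fair_partition (s : Finset α) (w : α → E) {M : ℕ} (hM : 0 < M) :
    ∃ cls : α → ℕ, (∀ x, cls x < M) ∧ ∀ c : ℕ, c < M → ∃ θ : ℝ,
      1 / (2 * M) ≤ θ ∧ θ ≤ 2 / M ∧
      ‖∑ x ∈ s.filter (fun x ↦ cls x = c), w x - θ • ∑ x ∈ s, w x‖ ≤
        2 * Real.sqrt (∑ x ∈ s, ‖w x‖ ^ 2) := by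
  set W : ℝ := Real.sqrt (∑ x ∈ s, ‖w x‖ ^ 2) with hW
  have hW0 : 0 ≤ W := Real.sqrt_nonneg _
  -- `M ≤ 2^r < 2M`
  set r : ℕ := Nat.clog 2 M with hr
  have hMr : M ≤ 2 ^ r := Nat.le_pow_clog one_lt_two M
  have hrM : 2 ^ r < 2 * M := by
    rcases eq_or_lt_of_le (Nat.one_le_iff_ne_zero.2 hM.ne') with h1 | h1
    · rw [hr, ← h1]
      simp
    · have hr0 : 0 < r := Nat.clog_pos one_lt_two h1
      have h2 : 2 ^ (r - 1) < M := by
        have := Nat.pow_pred_clog_lt_self one_lt_two h1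
        rwa [Nat.pred_eq_sub_one, ← hr] at this
      have h3 : 2 ^ r = 2 * 2 ^ (r - 1) := by
        rw [← pow_succ']
        congr 1
        omega
      omega
  obtain ⟨cls, hcls, herr⟩ := exists_dyadic_partition s w r
  have hpow : (0 : ℝ) < (2 : ℝ) ^ r := by positivity
  have hhalf : ((1 / 2 : ℝ) ^ r) = 1 / (2 : ℝ) ^ r := by rw [div_pow, one_pow]
  have hone : 1 - 1 / (2 : ℝ) ^ r ≤ 1 := by
    have : 0 ≤ 1 / (2 : ℝ) ^ r := by positivity
    linarith
  have herr' : ∀ c, c < 2 ^ r →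
      ‖∑ x ∈ s.filter (fun x ↦ cls x = c), w x - (1 / (2 : ℝ) ^ r) • ∑ x ∈ s, w x‖ ≤ W := by
    intro c hc
    have := herr c hc
    rw [hhalf] at this
    exact this.trans ((mul_le_of_le_one_left hW0 hone))
  have hMreal : (M : ℝ) ≤ (2 : ℝ) ^ r := by exact_mod_cast hMr
  have hrMreal : (2 : ℝ) ^ r < 2 * M := by exact_mod_cast hrM
  have hM0 : (0 : ℝ) < M := by exact_mod_cast hM
  refine ⟨fun x ↦ cls x % M, fun x ↦ Nat.mod_lt _ hM, fun c hc ↦ ?_⟩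
  -- the merged class is the dyadic class `c`, plus the class `c + M` if `c + M < 2^r`
  by_cases hcM : c + M < 2 ^ r
  · have hfilter : s.filter (fun x ↦ cls x % M = c) =
        s.filter (fun x ↦ cls x = c) ∪ s.filter (fun x ↦ cls x = c + M) := by
      ext x
      simp only [Finset.mem_filter, Finset.mem_union]
      have hx := hcls x
      constructor
      · rintro ⟨hxs, h⟩
        have : cls x = c ∨ cls x = c + M := by
          have h1 := Nat.div_add_mod (cls x) M
          have h2 : cls x / M < 2 := by
            rw [Nat.div_lt_iff_lt_mul hM]; omega
          rw [h] at h1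
          generalize hq : cls x / M = q at h1 h2
          have hq2 : q = 0 ∨ q = 1 := by omega
          rcases hq2 with rfl | rfl
          · left; omega
          · right; omega
        rcases this with h' | h'
        · exact Or.inl ⟨hxs, h'⟩
        · exact Or.inr ⟨hxs, h'⟩
      · rintro (⟨hxs, h⟩ | ⟨hxs, h⟩)
        · exact ⟨hxs, by rw [h]; exact Nat.mod_eq_of_lt hc⟩
        · refine ⟨hxs, ?_⟩
          rw [h, Nat.add_mod_right, Nat.mod_eq_of_lt hc]
    have hdisj : Disjoint (s.filter (fun x ↦ cls x = c)) (s.filter (fun x ↦ cls x = c + M)) := by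
      rw [Finset.disjoint_filter]
      intro x _ h1 h2
      omega
    refine ⟨2 / (2 : ℝ) ^ r, ?_, ?_, ?_⟩
    · rw [div_le_div_iff₀ (by positivity) hpow]
      nlinarith
    · rw [div_le_div_iff₀ hpow hM0]
      nlinarith
    · rw [hfilter, Finset.sum_union hdisj]
      have : ∑ x ∈ s.filter (fun x ↦ cls x = c), w x + ∑ x ∈ s.filter (fun x ↦ cls x = c + M), w x -
          (2 / (2 : ℝ) ^ r) • ∑ x ∈ s, w x =
          (∑ x ∈ s.filter (fun x ↦ cls x = c), w x - (1 / (2 : ℝ) ^ r) • ∑ x ∈ s, w x) +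
          (∑ x ∈ s.filter (fun x ↦ cls x = c + M), w x - (1 / (2 : ℝ) ^ r) • ∑ x ∈ s, w x) := by
        rw [show (2 / (2 : ℝ) ^ r) = 1 / (2 : ℝ) ^ r + 1 / (2 : ℝ) ^ r by ring, add_smul]
        abel
      rw [this]
      calc _ ≤ W + W := (norm_add_le _ _).trans (add_le_add (herr' c (by omega)) (herr' _ hcM))
        _ = 2 * W := by ring
  · have hfilter : s.filter (fun x ↦ cls x % M = c) = s.filter (fun x ↦ cls x = c) := by
      ext x
      simp only [Finset.mem_filter]
      have hx := hcls x
      constructor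
      · rintro ⟨hxs, h⟩
        refine ⟨hxs, ?_⟩
        have h1 := Nat.div_add_mod (cls x) M
        have h2 : cls x / M < 2 := by
          rw [Nat.div_lt_iff_lt_mul hM]; omega
        rw [h] at h1
        generalize hq : cls x / M = q at h1 h2
        have hq2 : q = 0 ∨ q = 1 := by omega
        rcases hq2 with rfl | rfl
        · omega
        · omega
      · rintro ⟨hxs, h⟩
        exact ⟨hxs, by rw [h]; exact Nat.mod_eq_of_lt hc⟩
    refine ⟨1 / (2 : ℝ) ^ r, ?_, ?_, ?_⟩
    · rw [div_le_div_iff₀ (by positivity) hpow]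
      nlinarith
    · rw [div_le_div_iff₀ hpow hM0]
      nlinarith
    · rw [hfilter]
      calc _ ≤ W := herr' c (by omega)
        _ ≤ 2 * W := by linarith

end VectorBalancing

end Literature.Combinatorics
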